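import Summits.ValiantsHypothesis.ValiantsHypothesis.Theorems.SymPencilPerFourBlocks

/-!
# Route `SymPencil` — the Hessian of `per_4` has rank `≥ 4` unless all `2 × 2` subpermanents
# vanish: the "swapped" blocks lemma
# (core of the rung `sdc(per_4) ≥ 23`, `--supports` stmt-ValiantsHypothesis-5674 `SdcSuperquadratic`)

Companion of `SymPencilPerFourBlocks(Sq)`: there the hypothesis was that for every base point `u`
the `s²`-coefficient of `s ↦ per_4 (u + s y)` is a quadratic form of small rank IN `y ∈ W`; here
the hypothesis is the SWAPPED one — for every `y ∈ W` the `s²`-coefficient is a sum of `|ι| < 4`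
weighted squares of linear functionals OF THE BASE POINT `u` (i.e. `rank (Hess per_4)(y) ≤ 3`).

* `eval_perPoly_blockUnits_add_smul`: `per_4 (α E₂₂ + β E₃₃ + γ E₂₃ + δ E₃₂ + s y) =
  s² (αβ + γδ)(y₀₀ y₁₁ + y₀₁ y₁₀) + s³ c₃ + s⁴ c₄`.
* `perm_two_zero_one_of_sum_sq_swap`: the swapped hypothesis at `y` with `|ι| < 4` forces
  `y₀₀ y₁₁ + y₀₁ y₁₀ = 0` (the form `(α,β,γ,δ) ↦ (αβ + γδ)·p` on `K⁴` has a radical vector only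
  if `p = 0`).
* `perm_two_blocks_of_sum_sq_swap`: hence (row/column permutations) ALL `2 × 2` subpermanents
  of `y` vanish; `finrank_le_four_of_sum_sq_swap`: a subspace with the swapped property has
  dimension `≤ 4` (`SymPencilPerFourBlocks.finrank_le_four_of_perm_two_blocks`).

[folklore]
-/

noncomputable section

-- single-conjunct layout: Sub = Summit, duplicated namespace component intended
set_option linter.dupNamespace false

namespace Summit.ValiantsHypothesis.ValiantsHypothesis.Theorems.SymPencilPerFourHessianBlocks

open Matrix MvPolynomial Finset Module
open Literature.Computability.AlgebraicComplexity
open Literature.Computability.AlgebraicComplexity.AlperBogartVelasco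
open Summit.ValiantsHypothesis.ValiantsHypothesis.Theorems.SymPencilPerFourBlocks

variable {K : Type*} [Field K]

/-- **`per_4 (α E₂₂ + β E₃₃ + γ E₂₃ + δ E₃₂ + s y)` as a polynomial in `s`**: the coefficient of
`s²` is `(αβ + γδ)·(y₀₀ y₁₁ + y₀₁ y₁₀)`, there is no constant or linear term. [folklore] -/
theorem eval_perPoly_blockUnits_add_smul (v : Fin 4 → K) (y : Fin 4 × Fin 4 → K) :
    ∃ c₃ c₄ : K, ∀ s : K,
      eval ((fun p : Fin 4 × Fin 4 => if p = (2, 2) then v 0 else if p = (3, 3) then v 1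
          else if p = (2, 3) then v 2 else if p = (3, 2) then v 3 else 0) + s • y)
        (perPoly (Fin 4) K) =
        s ^ 2 * ((v 0 * v 1 + v 2 * v 3) * (y (0, 0) * y (1, 1) + y (0, 1) * y (1, 0))) +
          s ^ 3 * c₃ + s ^ 4 * c₄ := by
  obtain ⟨e20, e21, e22, e30, e31, e32⟩ := (succAbove_fin_four : _ ∧ _)
  refine ⟨v 0 * ((Matrix.of fun i j => y (i, j)).submatrix (2 : Fin 4).succAbove
        (2 : Fin 4).succAbove).permanent +
      v 1 * ((Matrix.of fun i j => y (i, j)).submatrix (3 : Fin 4).succAbove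
        (3 : Fin 4).succAbove).permanent +
      v 2 * ((Matrix.of fun i j => y (i, j)).submatrix (2 : Fin 4).succAbove
        (3 : Fin 4).succAbove).permanent +
      v 3 * ((Matrix.of fun i j => y (i, j)).submatrix (3 : Fin 4).succAbove
        (2 : Fin 4).succAbove).permanent,
    (Matrix.of fun i j => y (i, j)).permanent, fun s => ?_⟩
  rw [eval_perPoly, Matrix.permanent_fin_four_row, Matrix.permanent_fin_four_row,
    Matrix.permanent_fin_three_row, Matrix.permanent_fin_three_row,
    Matrix.permanent_fin_three_row, Matrix.permanent_fin_three_row]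
  simp only [Matrix.of_apply, Matrix.submatrix_apply, Pi.add_apply, Pi.smul_apply, smul_eq_mul,
    e20, e21, e22, e30, e31, e32, Prod.mk.injEq]
  simp only [show ((0 : Fin 4) = 2) = False by decide, show ((1 : Fin 4) = 2) = False by decide,
    show ((3 : Fin 4) = 2) = False by decide, show ((0 : Fin 4) = 3) = False by decide,
    show ((1 : Fin 4) = 3) = False by decide, show ((2 : Fin 4) = 3) = False by decide,
    and_false, and_true, if_false, if_true, and_self]
  ring

/-- Coefficient extraction: if `e₀ + e₁ s + Q s² = q s² + c₃ s³ + c₄ s⁴` for all `s`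
(characteristic `0`), then `Q = q`. [folklore] -/
theorem coeff_two_eq_of_forall [CharZero K] {e₀ e₁ Q q c₃ c₄ : K}
    (P : ∀ s : K, e₀ + s * e₁ + s ^ 2 * Q = s ^ 2 * q + s ^ 3 * c₃ + s ^ 4 * c₄) : Q = q := by
  have h0 := P 0
  have h1 := P 1
  have h1' := P (-1)
  have h2 := P 2
  have h2' := P (-2)
  have h24 : (24 : K) * (Q - q) = 0 := by
    linear_combination 16 * (h1 + h1') - (h2 + h2') - 30 * h0
  have h24' : (24 : K) ≠ 0 := by norm_num
  exact sub_eq_zero.1 ((mul_eq_zero.1 h24).resolve_left h24')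

/-- From the swapped hypothesis at `y` (`|ι| < 4` squares of linear functionals of the base
point): the `2 × 2` subpermanent on rows/columns `{0,1}` vanishes. [folklore] -/
theorem perm_two_zero_one_of_sum_sq_swap [CharZero K] {ι : Type*} [Fintype ι]
    (hι : Fintype.card ι < 4) (y : Fin 4 × Fin 4 → K) (c : ι → K)
    (Λ : ι → ((Fin 4 × Fin 4 → K) →ₗ[K] K))
    (h : ∀ u : Fin 4 × Fin 4 → K, ∃ e₀ e₁ : K, ∀ s : K,
      eval (u + s • y) (perPoly (Fin 4) K) = e₀ + s * e₁ + s ^ 2 * ∑ k, c k * (Λ k u) ^ 2) :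
    y (0, 0) * y (1, 1) + y (0, 1) * y (1, 0) = 0 := by
  classical
  set q := y (0, 0) * y (1, 1) + y (0, 1) * y (1, 0) with hq
  -- the four-parameter family of base points `α E₂₂ + β E₃₃ + γ E₂₃ + δ E₃₂`, linear in `v`
  let U : (Fin 4 → K) →ₗ[K] (Fin 4 × Fin 4 → K) :=
    { toFun := fun v p => if p = (2, 2) then v 0 else if p = (3, 3) then v 1
        else if p = (2, 3) then v 2 else if p = (3, 2) then v 3 else 0
      map_add' := fun v₁ v₂ => by
        ext p
        simp only [Pi.add_apply]
        split_ifs <;> simp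
      map_smul' := fun a v => by
        ext p
        simp only [Pi.smul_apply, smul_eq_mul, RingHom.id_apply]
        split_ifs <;> simp }
  have hU : ∀ v, U v = fun p => if p = (2, 2) then v 0 else if p = (3, 3) then v 1
      else if p = (2, 3) then v 2 else if p = (3, 2) then v 3 else 0 := fun v => rfl
  -- the `s²`-coefficient along the family
  have hS : ∀ v : Fin 4 → K,
      ∑ k, c k * (Λ k (U v)) ^ 2 = (v 0 * v 1 + v 2 * v 3) * q := by
    intro v
    obtain ⟨e₀, e₁, he⟩ := h (U v)
    obtain ⟨c₃, c₄, hc⟩ := eval_perPoly_blockUnits_add_smul v y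
    exact coeff_two_eq_of_forall fun s => by rw [← he s, hU, hc s]
  -- a common-kernel vector of the `Λ_k ∘ U`
  let M : (Fin 4 → K) →ₗ[K] (ι → K) := LinearMap.pi fun k => (Λ k).comp U
  have hM : ∀ v k, M v k = Λ k (U v) := fun v k => rfl
  have hker : LinearMap.ker M ≠ ⊥ := LinearMap.ker_ne_bot_of_finrank_lt (by
    rw [Module.finrank_fintype_fun_eq_card, Module.finrank_fintype_fun_eq_card, Fintype.card_fin]
    exact hι)
  obtain ⟨v₀, hv₀, hv₀0⟩ := Submodule.exists_mem_ne_zero_of_ne_bot hker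
  have hΛ0 : ∀ k, Λ k (U v₀) = 0 := fun k => by
    have := congr_fun (LinearMap.mem_ker.1 hv₀) k
    rwa [hM] at this
  have hinv : ∀ v : Fin 4 → K, (v₀ 0 + v 0) * (v₀ 1 + v 1) + (v₀ 2 + v 2) * (v₀ 3 + v 3) =
      v 0 * v 1 + v 2 * v 3 ∨ q = 0 := by
    intro v
    have h1 := hS (v₀ + v)
    simp only [map_add, hΛ0, zero_add, Pi.add_apply] at h1
    rw [hS v] at h1
    exact mul_eq_mul_right_iff.1 h1.symm
  by_contra hq0
  have hinv' : ∀ v : Fin 4 → K, (v₀ 0 + v 0) * (v₀ 1 + v 1) + (v₀ 2 + v 2) * (v₀ 3 + v 3) =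
      v 0 * v 1 + v 2 * v 3 := fun v => (hinv v).resolve_right hq0
  have e0 := hinv' 0
  have e1 := hinv' (Pi.single 0 1)
  have e2 := hinv' (Pi.single 1 1)
  have e3 := hinv' (Pi.single 2 1)
  have e4 := hinv' (Pi.single 3 1)
  simp only [Pi.zero_apply, Pi.single_apply] at e0 e1 e2 e3 e4
  simp only [show ((1 : Fin 4) = 0) = False by decide, show ((2 : Fin 4) = 0) = False by decide,
    show ((3 : Fin 4) = 0) = False by decide, show ((0 : Fin 4) = 1) = False by decide,
    show ((2 : Fin 4) = 1) = False by decide, show ((3 : Fin 4) = 1) = False by decide,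
    show ((0 : Fin 4) = 2) = False by decide, show ((1 : Fin 4) = 2) = False by decide,
    show ((3 : Fin 4) = 2) = False by decide, show ((0 : Fin 4) = 3) = False by decide,
    show ((1 : Fin 4) = 3) = False by decide, show ((2 : Fin 4) = 3) = False by decide,
    if_true, if_false] at e0 e1 e2 e3 e4
  apply hv₀0
  have a0 : v₀ 0 = 0 := by linear_combination e2 - e0
  have a1 : v₀ 1 = 0 := by linear_combination e1 - e0
  have a2 : v₀ 2 = 0 := by linear_combination e4 - e0
  have a3 : v₀ 3 = 0 := by linear_combination e3 - e0
  ext i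
  fin_cases i
  · exact a0
  · exact a1
  · exact a2
  · exact a3

/-- **All `2 × 2` subpermanents of `y` vanish under the swapped hypothesis at `y`.** [folklore] -/
theorem perm_two_blocks_of_sum_sq_swap [CharZero K] {ι : Type*} [Fintype ι]
    (hι : Fintype.card ι < 4) (y : Fin 4 × Fin 4 → K)
    (h : ∃ (c : ι → K) (Λ : ι → ((Fin 4 × Fin 4 → K) →ₗ[K] K)),
      ∀ u : Fin 4 × Fin 4 → K, ∃ e₀ e₁ : K, ∀ s : K,
        eval (u + s • y) (perPoly (Fin 4) K) = e₀ + s * e₁ + s ^ 2 * ∑ k, c k * (Λ k u) ^ 2) :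
    ∀ i k j l : Fin 4, i ≠ k → j ≠ l → y (i, j) * y (k, l) + y (i, l) * y (k, j) = 0 := by
  intro i k j l hik hjl
  obtain ⟨c, Λ, hcΛ⟩ := h
  obtain ⟨σ, hσ0, hσ1⟩ := exists_perm_zero_one i k hik
  obtain ⟨τ, hτ0, hτ1⟩ := exists_perm_zero_one j l hjl
  set e := Equiv.prodCongr σ τ with he
  -- the transported matrix `y' = y ∘ e` satisfies the swapped hypothesis with `Λ_k ∘ (· ∘ e⁻¹)`
  have h' : ∀ u : Fin 4 × Fin 4 → K, ∃ e₀ e₁ : K, ∀ s : K,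
      eval (u + s • (y ∘ e)) (perPoly (Fin 4) K) =
        e₀ + s * e₁ + s ^ 2 * ∑ k, c k * ((Λ k).comp (LinearMap.funLeft K K e.symm) u) ^ 2 := by
    intro u
    obtain ⟨e₀, e₁, hu⟩ := hcΛ (u ∘ e.symm)
    refine ⟨e₀, e₁, fun s => ?_⟩
    have hcomp : u + s • (y ∘ e) = (u ∘ e.symm + s • y) ∘ e := by
      ext p
      simp
    rw [hcomp, he, eval_perPoly_comp_prodCongr, ← he, hu s]
    rfl
  have h2 := perm_two_zero_one_of_sum_sq_swap hι (y ∘ e) c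
    (fun k => (Λ k).comp (LinearMap.funLeft K K e.symm)) h'
  simp only [Function.comp_apply, he, Equiv.prodCongr_apply, Prod.map_apply, hσ0, hσ1, hτ0,
    hτ1] at h2
  exact h2

/-- **A subspace with the swapped property (`|ι| < 4`) has dimension `≤ 4`.** [folklore] -/
theorem finrank_le_four_of_sum_sq_swap [CharZero K] {ι : Type*} [Fintype ι]
    (hι : Fintype.card ι < 4) (W : Submodule K (Fin 4 × Fin 4 → K))
    (hW : ∀ y ∈ W, ∃ (c : ι → K) (Λ : ι → ((Fin 4 × Fin 4 → K) →ₗ[K] K)),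
      ∀ u : Fin 4 × Fin 4 → K, ∃ e₀ e₁ : K, ∀ s : K,
        eval (u + s • y) (perPoly (Fin 4) K) = e₀ + s * e₁ + s ^ 2 * ∑ k, c k * (Λ k u) ^ 2) :
    finrank K W ≤ 4 :=
  finrank_le_four_of_perm_two_blocks W fun y hy i k j l hik hjl =>
    perm_two_blocks_of_sum_sq_swap hι y (hW y hy) i k j l hik hjl

end Summit.ValiantsHypothesis.ValiantsHypothesis.Theorems.SymPencilPerFourHessianBlocks

end
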